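import Literature.Computability.AlgebraicComplexity.BorderApolarityTriples
import HarnessLib

/-!
# The candidate triple of an approximate decomposition (general position in all three slots)

Topic `Literature/Computability/AlgebraicComplexity`. Sequel of `BorderApolarityTriples.lean`
(the `(111)`-test space `tripleInter`, candidate triples `IsCandidateTriple`, the points
`u_ρ ⊗ v_ρ ⊗ w_ρ` and the limit of their span) and `BorderApolarityCandidates.lean`: PROVES that
every order-`h` approximate decomposition of `t` with `r` triads yields a candidate triple
(`BorderApolarity.exists_candidateTriple_of_isApproxDecomposition`; Conner–Harper–Landsberg
2023, §2.3 (i)–(iii) in all tri-degrees of total degree `≤ 3`, span side). The new ingredient is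
general position in ALL THREE slots at once: perturb `u, v, w` by `ε^N` at coordinate triples
`(pa ρ, pb ρ, pc ρ)` (`isApproxDecomposition_pert₁₂₃`); if the three pair projections of
`ρ ↦ (pa ρ, pb ρ, pc ρ)` are injective, the doubled points of each pair are independent
(`BorderApolarityCandidates.lean`) and so are the points `u_ρ ⊗ v_ρ ⊗ w_ρ`
(`linearIndependent_pt₄_pert`: their evaluation minor is `ε^{3N} · 1 +` lower order).

## References

* A. Conner, A. Harper, J. M. Landsberg, *New lower bounds for matrix multiplication and `det₃`*,
  Forum Math. Pi 11 (2023) e17, arXiv:1911.07981 — §2.3, §3. [ConnerHarperLandsberg2023]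
* W. Buczyńska, J. Buczyński, *Apolarity, border rank, and multigraded Hilbert scheme*, Duke Math.
  J. 170 (2021) — Thm. 1.2. [BuczynskaBuczynski2021]
-/

noncomputable section

open Polynomial
open scoped Polynomial BigOperators

namespace Literature.Computability.AlgebraicComplexity

namespace BorderApolarity

open TensorApolarity

universe u v

variable {K : Type u} [Field K]
variable {ι κ μ : Type}

/-! ## General position in all three slots -/

section GeneralPosition

variable {r : ℕ} [DecidableEq ι] [DecidableEq κ] [DecidableEq μ]

/-- Perturbing ALL THREE slots by `ε^N` (`N > h`) keeps an order-`h` approximate decomposition.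
[cite: ConnerHarperLandsberg2023, §2.3 (ii)] -/
theorem isApproxDecomposition_pert₁₂₃ {h : ℕ} {t : ι → κ → μ → K} {u : Fin r → ι → K[X]}
    {v : Fin r → κ → K[X]} {w : Fin r → μ → K[X]} (hd : IsApproxDecomposition h t u v w)
    (pa : Fin r → ι) (pb : Fin r → κ) (pc : Fin r → μ) {N : ℕ} (hN : h < N) :
    IsApproxDecomposition h t (pertX u pa N) (pertX v pb N) (pertX w pc N) := by
  intro a b c j hj
  have hsplit : ∑ ρ, pertX u pa N ρ a * pertX v pb N ρ b * pertX w pc N ρ c =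
      ∑ ρ, u ρ a * v ρ b * w ρ c + X ^ N * ∑ ρ,
        (u ρ a * v ρ b * (if c = pc ρ then 1 else 0) +
          (u ρ a * (if b = pb ρ then 1 else 0) + (if a = pa ρ then 1 else 0) * v ρ b +
            X ^ N * ((if a = pa ρ then 1 else 0) * if b = pb ρ then 1 else 0)) *
          (w ρ c + X ^ N * if c = pc ρ then 1 else 0)) := by
    rw [Finset.mul_sum, ← Finset.sum_add_distrib]
    refine Finset.sum_congr rfl fun ρ _ => ?_
    rw [pertX_apply, pertX_apply, pertX_apply]
    ring
  rw [hsplit, coeff_add, coeff_X_pow_mul', if_neg (by omega), add_zero]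
  exact hd a b c j hj

omit [DecidableEq ι] [DecidableEq κ] [DecidableEq μ] in
/-- An approximate decomposition of `t` is one of the rotated tensor `(b, c, a) ↦ t a b c` with the
slots rotated. [folklore] -/
theorem isApproxDecomposition_rotate {h : ℕ} {t : ι → κ → μ → K} {u : Fin r → ι → K[X]}
    {v : Fin r → κ → K[X]} {w : Fin r → μ → K[X]} (hd : IsApproxDecomposition h t u v w) :
    IsApproxDecomposition h (fun b c a => t a b c) v w u := by
  intro b c a j hj
  have : ∑ ρ, v ρ b * w ρ c * u ρ a = ∑ ρ, u ρ a * v ρ b * w ρ c :=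
    Finset.sum_congr rfl fun ρ _ => by ring
  rw [this]
  exact hd a b c j hj

omit [DecidableEq ι] [DecidableEq κ] [DecidableEq μ] in
/-- An approximate decomposition of `t` is one of the transposed tensor `(a, c, b) ↦ t a b c` with
the last two slots swapped. [folklore] -/
theorem isApproxDecomposition_swap {h : ℕ} {t : ι → κ → μ → K} {u : Fin r → ι → K[X]}
    {v : Fin r → κ → K[X]} {w : Fin r → μ → K[X]} (hd : IsApproxDecomposition h t u v w) :
    IsApproxDecomposition h (fun a c b => t a b c) u w v := by
  intro a c b j hj
  have : ∑ ρ, u ρ a * w ρ c * v ρ b = ∑ ρ, u ρ a * v ρ b * w ρ c :=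
    Finset.sum_congr rfl fun ρ _ => by ring
  rw [this]
  exact hd a b c j hj

variable {u : Fin r → ι → K[X]} {v : Fin r → κ → K[X]} {w : Fin r → μ → K[X]}
variable {pa : Fin r → ι} {pb : Fin r → κ} {pc : Fin r → μ} {N : ℕ}

/-- The diagonal of the `(111)` evaluation minor is `ε^{3N} +` lower order. [folklore] -/
theorem degree_diag111_lt (hu : ∀ ρ a, (u ρ a).natDegree < N) (hv : ∀ ρ b, (v ρ b).natDegree < N)
    (hw : ∀ ρ c, (w ρ c).natDegree < N) (hN : 0 < N) (ρ : Fin r) :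
    (pertX u pa N ρ (pa ρ) * pertX v pb N ρ (pb ρ) * pertX w pc N ρ (pc ρ) - X ^ (3 * N)).degree <
      ((3 * N : ℕ) : WithBot ℕ) := by
  set p := u ρ (pa ρ)
  set q := v ρ (pb ρ)
  set s := w ρ (pc ρ)
  have hp : p.natDegree ≤ N - 1 := Nat.le_sub_one_of_lt (hu ρ _)
  have hq : q.natDegree ≤ N - 1 := Nat.le_sub_one_of_lt (hv ρ _)
  have hs : s.natDegree ≤ N - 1 := Nat.le_sub_one_of_lt (hw ρ _)
  have e : pertX u pa N ρ (pa ρ) * pertX v pb N ρ (pb ρ) * pertX w pc N ρ (pc ρ) - X ^ (3 * N) =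
      X ^ (2 * N) * (p + q + s) + X ^ N * (p * q + p * s + q * s) + p * q * s := by
    rw [pertX_apply, pertX_apply, pertX_apply, if_pos rfl, if_pos rfl, if_pos rfl]
    ring
  rw [e]
  have hXn : ∀ n : ℕ, ((X : K[X]) ^ n).natDegree ≤ n := fun n => natDegree_X_pow_le n
  have h1 : (p + q + s).natDegree ≤ N - 1 :=
    (natDegree_add_le _ _).trans (max_le ((natDegree_add_le _ _).trans (max_le hp hq)) hs)
  have hpq : (p * q).natDegree ≤ 2 * (N - 1) := natDegree_mul_le.trans (by omega)
  have hps : (p * s).natDegree ≤ 2 * (N - 1) := natDegree_mul_le.trans (by omega)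
  have hqs : (q * s).natDegree ≤ 2 * (N - 1) := natDegree_mul_le.trans (by omega)
  have h2 : (p * q + p * s + q * s).natDegree ≤ 2 * (N - 1) :=
    (natDegree_add_le _ _).trans (max_le ((natDegree_add_le _ _).trans (max_le hpq hps)) hqs)
  have h3 : (p * q * s).natDegree ≤ 3 * (N - 1) := natDegree_mul_le.trans (by omega)
  have hdeg : (X ^ (2 * N) * (p + q + s) + X ^ N * (p * q + p * s + q * s) + p * q * s).natDegree ≤
      3 * N - 1 := by
    refine (natDegree_add_le _ _).trans (max_le ((natDegree_add_le _ _).trans (max_le ?_ ?_)) ?_)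
    · refine natDegree_mul_le.trans ?_
      have := hXn (2 * N); omega
    · refine natDegree_mul_le.trans ?_
      have := hXn N; omega
    · omega
  refine (degree_le_natDegree).trans_lt ?_
  exact_mod_cast Nat.lt_of_le_of_lt hdeg (by omega)

/-- Off the diagonal the `(111)` evaluation minor has degree `< 3N` (the coordinate triples are
distinct, so one factor is unperturbed). [folklore] -/
theorem degree_off111_lt (hinj : Function.Injective fun ρ => (pa ρ, pb ρ, pc ρ))
    (hu : ∀ ρ a, (u ρ a).natDegree < N) (hv : ∀ ρ b, (v ρ b).natDegree < N)
    (hw : ∀ ρ c, (w ρ c).natDegree < N) (hN : 0 < N) {ρ j : Fin r} (hρj : ρ ≠ j) :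
    (pertX u pa N ρ (pa j) * pertX v pb N ρ (pb j) * pertX w pc N ρ (pc j)).degree <
      ((3 * N : ℕ) : WithBot ℕ) := by
  have hne : pa j ≠ pa ρ ∨ pb j ≠ pb ρ ∨ pc j ≠ pc ρ := by
    by_contra h
    push Not at h
    exact hρj (hinj (Prod.ext h.1.symm (Prod.ext h.2.1.symm h.2.2.symm)))
  have ha := natDegree_pertX_le (pa := pa) hu ρ (pa j)
  have hb := natDegree_pertX_le (pa := pb) hv ρ (pb j)
  have hc := natDegree_pertX_le (pa := pc) hw ρ (pc j)
  have hdeg : (pertX u pa N ρ (pa j) * pertX v pb N ρ (pb j) * pertX w pc N ρ (pc j)).natDegree ≤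
      3 * N - 1 := by
    refine natDegree_mul_le.trans ?_
    have hab := natDegree_mul_le (p := pertX u pa N ρ (pa j)) (q := pertX v pb N ρ (pb j))
    rcases hne with h | h | h
    · rw [pertX_of_ne h] at hab ⊢
      have := hu ρ (pa j)
      omega
    · rw [pertX_of_ne h] at hab ⊢
      have := hv ρ (pb j)
      omega
    · rw [pertX_of_ne h]
      have := hw ρ (pc j)
      omega
  refine (degree_le_natDegree).trans_lt ?_
  exact_mod_cast Nat.lt_of_le_of_lt hdeg (by omega)

variable (L : Type v) [Field L] [Algebra K[X] L] [IsFractionRing K[X] L]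

/-- **The perturbed points `u_ρ ⊗ v_ρ ⊗ w_ρ` are `L`-independent** (their evaluation minor at the
coordinates `(pa j, pb j, pc j)` is `ε^{3N} · 1 +` lower order). [cite: ConnerHarperLandsberg2023, §2.3 (ii)] -/
theorem linearIndependent_pt₄_pert (hinj : Function.Injective fun ρ => (pa ρ, pb ρ, pc ρ))
    (hu : ∀ ρ a, (u ρ a).natDegree < N) (hv : ∀ ρ b, (v ρ b).natDegree < N)
    (hw : ∀ ρ c, (w ρ c).natDegree < N) (hN : 0 < N) :
    LinearIndependent L fun ρ =>
      polyVec L (pt₄ (pertX u pa N) (pertX v pb N) (pertX w pc N) ρ) := by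
  set M₀ : Matrix (Fin r) (Fin r) K[X] := Matrix.of fun ρ j =>
    pertX u pa N ρ (pa j) * pertX v pb N ρ (pb j) * pertX w pc N ρ (pc j) with hM₀
  have hdet : M₀.det ≠ 0 :=
    det_ne_zero_of_degree_lt (3 * N) M₀ (fun ρ => degree_diag111_lt hu hv hw hN ρ)
      (fun ρ j hρj => degree_off111_lt hinj hu hv hw hN hρj)
  have hdetL : (M₀.map (algebraMap K[X] L)).det ≠ 0 := by
    rw [← RingHom.mapMatrix_apply, ← RingHom.map_det]
    exact (IsFractionRing.injective K[X] L).ne_iff' (map_zero _) |>.2 hdet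
  rw [Fintype.linearIndependent_iff]
  intro g hg ρ₀
  have hvec : Matrix.vecMul g (M₀.map (algebraMap K[X] L)) = 0 := by
    funext j
    have hj := congr_fun hg (pa j, pb j, pc j)
    simp only [Finset.sum_apply, Pi.smul_apply, smul_eq_mul, Pi.zero_apply, polyVec_apply,
      pt₄, map_mul] at hj
    simp only [Matrix.vecMul, dotProduct, Matrix.map_apply, Matrix.of_apply, Pi.zero_apply,
      map_mul, hM₀]
    rw [← hj]
  exact congr_fun (Matrix.eq_zero_of_vecMul_eq_zero hdetL hvec) ρ₀

end GeneralPosition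

/-! ## The candidate triple of a decomposition -/

section Candidate

variable {r : ℕ} [Fintype ι] [Fintype κ] [Fintype μ] [DecidableEq ι] [DecidableEq κ] [DecidableEq μ]

/-- **Every approximate decomposition yields a candidate triple** (elementary border apolarity,
span side, tri-degrees of total degree `≤ 3`): perturb all three slots at coordinate triples
`(pa ρ, pb ρ, pc ρ)` whose three pair projections are injective, and take the limits at `ε = 0` of
the `L`-spans of `u_ρ ⊗ v_ρ`, `v_ρ ⊗ w_ρ`, `u_ρ ⊗ w_ρ` (and, for the tests, of the doubled points and
of `u_ρ ⊗ v_ρ ⊗ w_ρ`). [cite: ConnerHarperLandsberg2023, §2.3 (i)–(iii) and §3]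
[cite: BuczynskaBuczynski2021, Thm. 1.2] -/
theorem exists_candidateTriple_of_isApproxDecomposition {h : ℕ} {t : ι → κ → μ → K}
    {u : Fin r → ι → K[X]} {v : Fin r → κ → K[X]} {w : Fin r → μ → K[X]}
    (hd : IsApproxDecomposition h t u v w) (pa : Fin r → ι) (pb : Fin r → κ) (pc : Fin r → μ)
    (hAB : Function.Injective fun ρ => (pa ρ, pb ρ))
    (hBC : Function.Injective fun ρ => (pb ρ, pc ρ))
    (hAC : Function.Injective fun ρ => (pa ρ, pc ρ)) :
    ∃ (E₁ : Submodule K (ι × κ → K)) (E₂ : Submodule K (κ × μ → K))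
      (E₃ : Submodule K (ι × μ → K)), IsCandidateTriple r t E₁ E₂ E₃ := by
  -- a common degree bound and the perturbation
  set N := degBound u v + degBound v w + h + 1 with hN
  have hu : ∀ ρ a, (u ρ a).natDegree < N := fun ρ a =>
    lt_of_le_of_lt (natDegree_v_le_degBound u v ρ a) (by omega)
  have hv : ∀ ρ b, (v ρ b).natDegree < N := fun ρ b =>
    lt_of_le_of_lt (natDegree_w_le_degBound u v ρ b) (by omega)
  have hw : ∀ ρ c, (w ρ c).natDegree < N := fun ρ c =>
    lt_of_le_of_lt (natDegree_w_le_degBound v w ρ c) (by omega)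
  have hN0 : 0 < N := by omega
  set u' := pertX u pa N with hu'
  set v' := pertX v pb N with hv'
  set w' := pertX w pc N with hw'
  have hd' : IsApproxDecomposition h t u' v' w' := isApproxDecomposition_pert₁₂₃ hd pa pb pc (by omega)
  have hABC : Function.Injective fun ρ => (pa ρ, pb ρ, pc ρ) := by
    intro ρ ρ' hρ
    simp only [Prod.mk.injEq] at hρ
    exact hAB (Prod.ext hρ.1 hρ.2.1)
  let L := FractionRing K[X]
  refine ⟨limSub K L (W₁ u' v' L), limSub K L (W₁ v' w' L), limSub K L (W₁ u' w' L), ?_⟩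
  refine ⟨finrank_limSub_W₁_le u' v' L, finrank_limSub_W₁_le v' w' L, finrank_limSub_W₁_le u' w' L,
    slice_mem_limSub_W₁ u' v' L hd', slice_mem_limSub_W₁ v' w' L (isApproxDecomposition_rotate hd'),
    slice_mem_limSub_W₁ u' w' L (isApproxDecomposition_swap hd'), ?_, ?_, ?_, ?_, ?_, ?_, ?_⟩
  · calc r = Module.finrank K (limSub K L (W₂ u' v' L)) :=
          (finrank_limSub_W₂_eq u' v' L (linearIndependent_pt₂_pert L hAB hu hv hN0)).symm
      _ ≤ _ := Submodule.finrank_mono (limSub_W₂_le u' v' L)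
  · calc r = Module.finrank K (limSub K L (W₃ u' v' L)) :=
          (finrank_limSub_W₃_eq u' v' L (linearIndependent_pt₃_pert L hAB hu hv hN0)).symm
      _ ≤ _ := Submodule.finrank_mono (limSub_W₃_le u' v' L)
  · calc r = Module.finrank K (limSub K L (W₂ v' w' L)) :=
          (finrank_limSub_W₂_eq v' w' L (linearIndependent_pt₂_pert L hBC hv hw hN0)).symm
      _ ≤ _ := Submodule.finrank_mono (limSub_W₂_le v' w' L)
  · calc r = Module.finrank K (limSub K L (W₃ v' w' L)) :=
          (finrank_limSub_W₃_eq v' w' L (linearIndependent_pt₃_pert L hBC hv hw hN0)).symm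
      _ ≤ _ := Submodule.finrank_mono (limSub_W₃_le v' w' L)
  · calc r = Module.finrank K (limSub K L (W₂ u' w' L)) :=
          (finrank_limSub_W₂_eq u' w' L (linearIndependent_pt₂_pert L hAC hu hw hN0)).symm
      _ ≤ _ := Submodule.finrank_mono (limSub_W₂_le u' w' L)
  · calc r = Module.finrank K (limSub K L (W₃ u' w' L)) :=
          (finrank_limSub_W₃_eq u' w' L (linearIndependent_pt₃_pert L hAC hu hw hN0)).symm
      _ ≤ _ := Submodule.finrank_mono (limSub_W₃_le u' w' L)
  · calc r = Module.finrank K (limSub K L (W₄ u' v' w' L)) :=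
          (finrank_limSub_W₄_eq u' v' w' L (linearIndependent_pt₄_pert L hABC hu hv hw hN0)).symm
      _ ≤ _ := Submodule.finrank_mono (limSub_W₄_le u' v' w' L)

end Candidate

end BorderApolarity

end Literature.Computability.AlgebraicComplexity

end
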